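import Mathlib
import HarnessLib

/-!
# Crux `EulerZoomLiouville.PowerGaugeEulerLiouville` (stmt-NavierStokesRegularity-19832), line `recurrent-past`, stub R2 — brick 1:
# WINDOW DENSITIES: a.e.-invariance, and SMEARING a set of window density zero over windows of length `h`

Route №10 `EulerZoomLiouville` (NavierStokesRegularity), crux E.  Line `recurrent-past` (ideator ns-idea-11 g3;
`Cruxes/PowerGaugeEulerLiouville/Lines/recurrent_past.lean`), stub R2 `stub_recurrentSlicesZero`.  Seat ns-ezl-w3.  The line's notion: a set
`S ⊆ ℝ` of past times has WINDOW DENSITY ZERO if `volume (S ∩ (−a², 0)) / a² → 0` as `a → ∞` (the normalisation of the landed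
`Backward.vanishesBackward_of_gauge`).  This file is the pure one-dimensional measure theory of R2 (theorems only, the density written out):

* `windowDensity_congr_ae`, `windowDensityZero_congr_ae` — the window density only depends on the a.e.-class of the set;
* `volume_smeared_inter_window_le` — **SMEARING**: for measurable `Bad` and `h > 0`, the set of times `σ` whose trailing window `(σ−h, σ)`
  meets `Bad` in measure `> h/2` satisfies `volume ({σ | h/2 < |Bad ∩ (σ−h,σ)|} ∩ (−a², 0)) ≤ 2 |Bad ∩ (−(a²+h), 0)|` (Markov in `σ`, then
  Tonelli: `∫_{(−a²,0)} |Bad ∩ (σ−h,σ)| dσ = ∫_{Bad} |{σ ∈ (−a²,0) : τ < σ < τ+h}| dτ ≤ h |Bad ∩ (−(a²+h), 0)|`);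
* `windowDensityZero_smeared` — hence the smeared set has window density zero as well (`(a²+h)/a² → 1`);
* `exists_good_time_in_window` — in a window `(σ−h, σ)` where `Bad` occupies measure `≤ h/2`, a measurable `G` occupies `≤ h/4` and `N` is
  null, some time avoids all three.

WHAT THIS IS NOT: not NS, not the crux — a helper `--supports` stmt-19832 (elementary measure theory); 19832 is a crux CLASS of Euler/NS strata
and stays OPEN; nothing here bears on NS regularity. [folklore]
-/

noncomputable section

-- flat `Theorems/<Route><Decl>…` files of one crux share the namespace of the crux (tree convention)
set_option linter.dupNamespace false

open MeasureTheory Set Filter Topology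
open scoped ENNReal Topology

namespace Summit.NavierStokesRegularity.NavierStokesRegularity.Theorems.PowerGaugeEulerLiouville.RecurrentPast

/-! ### The window density is an a.e.-invariant -/

/-- Sets that agree a.e. have the same window counts. [folklore] -/
theorem windowDensity_congr_ae {S S' : Set ℝ} (h : (S : Set ℝ) =ᵐ[volume] S') (a : ℝ) :
    volume (S ∩ Set.Ioo (-(a ^ 2)) 0) / ENNReal.ofReal (a ^ 2) =
      volume (S' ∩ Set.Ioo (-(a ^ 2)) 0) / ENNReal.ofReal (a ^ 2) := by
  rw [measure_congr (h.inter (ae_eq_refl (Set.Ioo (-(a ^ 2)) (0 : ℝ))))]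

/-- Sets that agree a.e. have window density zero simultaneously. [folklore] -/
theorem windowDensityZero_congr_ae {S S' : Set ℝ} (h : (S : Set ℝ) =ᵐ[volume] S')
    (hS : Tendsto (fun a : ℝ => volume (S ∩ Set.Ioo (-(a ^ 2)) 0) / ENNReal.ofReal (a ^ 2)) atTop (𝓝 0)) :
    Tendsto (fun a : ℝ => volume (S' ∩ Set.Ioo (-(a ^ 2)) 0) / ENNReal.ofReal (a ^ 2)) atTop (𝓝 0) := by
  refine hS.congr fun a => ?_
  exact windowDensity_congr_ae h a

/-! ### Smearing over trailing windows of length `h` -/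

/-- **Smearing bound.**  For measurable `Bad ⊆ ℝ`, `h > 0` and every window `(−a², 0)`:
`volume ({σ | h/2 < |Bad ∩ (σ−h, σ)|} ∩ (−a², 0)) ≤ 2 · |Bad ∩ (−(a²+h), 0)|` — Markov's inequality in `σ` and Tonelli for the indicator of
`{(σ, τ) : τ ∈ Bad, σ − h < τ < σ}`. [folklore] -/
theorem volume_smeared_inter_window_le {Bad : Set ℝ} (hBm : MeasurableSet Bad) {h : ℝ} (hh : 0 < h) (a : ℝ) :
    volume ({σ : ℝ | ENNReal.ofReal (h / 2) < volume (Bad ∩ Set.Ioo (σ - h) σ)} ∩ Set.Ioo (-(a ^ 2)) 0) ≤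
      2 * volume (Bad ∩ Set.Ioo (-(a ^ 2 + h)) 0) := by
  -- the smeared indicator `F(σ,τ) = 1_{Bad}(τ) 1_{(σ-h,σ)}(τ)`
  set P : Set (ℝ × ℝ) := {q | q.2 ∈ Bad ∧ q.1 - h < q.2 ∧ q.2 < q.1} with hP
  have hPm : MeasurableSet P :=
    (measurable_snd hBm).inter ((measurableSet_lt (measurable_fst.sub measurable_const) measurable_snd).inter
      (measurableSet_lt measurable_snd measurable_fst))
  set F : ℝ × ℝ → ℝ≥0∞ := P.indicator 1 with hF
  have hFm : Measurable F := measurable_one.indicator hPm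
  -- `φ(σ) = |Bad ∩ (σ-h,σ)| = ∫ F(σ,·)`
  have hφ : ∀ σ : ℝ, volume (Bad ∩ Set.Ioo (σ - h) σ) = ∫⁻ τ, F (σ, τ) := by
    intro σ
    have e : (fun τ => F (σ, τ)) = (Bad ∩ Set.Ioo (σ - h) σ).indicator 1 := by
      funext τ
      by_cases hτ : τ ∈ Bad ∩ Set.Ioo (σ - h) σ
      · rw [indicator_of_mem hτ, hF, indicator_of_mem (show (σ, τ) ∈ P from ⟨hτ.1, hτ.2.1, hτ.2.2⟩)]
        rfl
      · rw [indicator_of_notMem hτ, hF, indicator_of_notMem]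
        rintro ⟨h1, h2, h3⟩
        exact hτ ⟨h1, h2, h3⟩
    rw [e, lintegral_indicator_one (hBm.inter measurableSet_Ioo)]
  have hφm : Measurable fun σ : ℝ => ∫⁻ τ, F (σ, τ) := hFm.lintegral_prod_right'
  set I : Set ℝ := Set.Ioo (-(a ^ 2)) 0 with hI
  -- Markov in `σ` over the window `I`
  have h1 : ENNReal.ofReal (h / 2) *
      volume ({σ : ℝ | ENNReal.ofReal (h / 2) < volume (Bad ∩ Set.Ioo (σ - h) σ)} ∩ I) ≤
      ∫⁻ σ in I, volume (Bad ∩ Set.Ioo (σ - h) σ) := by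
    have hm := mul_meas_ge_le_lintegral₀ (μ := volume.restrict I)
      (f := fun σ => volume (Bad ∩ Set.Ioo (σ - h) σ)) (by simp_rw [hφ]; exact hφm.aemeasurable)
      (ENNReal.ofReal (h / 2))
    refine le_trans ?_ hm
    rw [Measure.restrict_apply' measurableSet_Ioo]
    have hsub : {σ : ℝ | ENNReal.ofReal (h / 2) < volume (Bad ∩ Set.Ioo (σ - h) σ)} ∩ I ⊆
        {σ : ℝ | ENNReal.ofReal (h / 2) ≤ volume (Bad ∩ Set.Ioo (σ - h) σ)} ∩ I :=
      inter_subset_inter_left _ fun σ (hσ : ENNReal.ofReal (h / 2) < volume (Bad ∩ Set.Ioo (σ - h) σ)) => hσ.le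
    exact mul_le_mul' le_rfl (measure_mono hsub)
  -- Tonelli: `∫_I φ = ∫_τ 1_{Bad}(τ) |{σ ∈ I : τ < σ < τ + h}| ≤ h |Bad ∩ (-(a²+h), 0)|`
  have h2 : ∫⁻ σ in I, volume (Bad ∩ Set.Ioo (σ - h) σ) ≤
      ENNReal.ofReal h * volume (Bad ∩ Set.Ioo (-(a ^ 2 + h)) 0) := by
    simp_rw [hφ]
    rw [lintegral_lintegral_swap (μ := volume.restrict I) (ν := volume) (f := fun σ τ => F (σ, τ)) hFm.aemeasurable]
    have hpt : ∀ τ : ℝ, ∫⁻ σ in I, F (σ, τ) ≤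
        (Bad ∩ Set.Ioo (-(a ^ 2 + h)) 0).indicator (fun _ => ENNReal.ofReal h) τ := by
      intro τ
      by_cases hτ : τ ∈ Bad ∩ Set.Ioo (-(a ^ 2 + h)) 0
      · rw [indicator_of_mem hτ]
        calc ∫⁻ σ in I, F (σ, τ) ≤ ∫⁻ σ in I, (Set.Ioo τ (τ + h)).indicator 1 σ := by
              refine lintegral_mono fun σ => ?_
              by_cases hσ : (σ, τ) ∈ P
              · have : σ ∈ Set.Ioo τ (τ + h) := ⟨hσ.2.2, by linarith [hσ.2.1]⟩
                rw [hF, indicator_of_mem hσ, indicator_of_mem this]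
                exact le_rfl
              · rw [hF, indicator_of_notMem hσ]
                exact bot_le
          _ ≤ ∫⁻ σ, (Set.Ioo τ (τ + h)).indicator 1 σ := lintegral_mono' Measure.restrict_le_self le_rfl
          _ = volume (Set.Ioo τ (τ + h)) := lintegral_indicator_one measurableSet_Ioo
          _ = ENNReal.ofReal h := by rw [Real.volume_Ioo]; ring_nf
      · rw [indicator_of_notMem hτ]
        refine le_of_eq ((setLIntegral_congr_fun measurableSet_Ioo fun σ hσ => ?_).trans lintegral_zero)
        -- on `I`, `F(σ,τ) = 0`: either `τ ∉ Bad`, or `τ ∉ (-(a²+h), 0)` contradicts `σ - h < τ < σ`, `σ ∈ I`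
        rw [hF, indicator_of_notMem]
        rintro ⟨hB, hlt1, hlt2⟩
        exact hτ ⟨hB, by linarith [hσ.1], by linarith [hσ.2]⟩
    calc ∫⁻ τ, ∫⁻ σ in I, F (σ, τ) ≤ ∫⁻ τ, (Bad ∩ Set.Ioo (-(a ^ 2 + h)) 0).indicator (fun _ => ENNReal.ofReal h) τ :=
          lintegral_mono hpt
      _ = ENNReal.ofReal h * volume (Bad ∩ Set.Ioo (-(a ^ 2 + h)) 0) := by
          rw [lintegral_indicator_const (hBm.inter measurableSet_Ioo)]
  -- cancel `ofReal (h/2)`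
  have hh2 : ENNReal.ofReal (h / 2) ≠ 0 := (ENNReal.ofReal_pos.2 (by positivity)).ne'
  have e2 : ENNReal.ofReal h = ENNReal.ofReal (h / 2) * 2 := by
    rw [← ENNReal.ofReal_ofNat 2, ← ENNReal.ofReal_mul (by positivity)]
    congr 1
    ring
  refine (ENNReal.mul_le_mul_iff_right hh2 ENNReal.ofReal_ne_top).1 ?_
  calc ENNReal.ofReal (h / 2) *
        volume ({σ : ℝ | ENNReal.ofReal (h / 2) < volume (Bad ∩ Set.Ioo (σ - h) σ)} ∩ I)
      ≤ ENNReal.ofReal h * volume (Bad ∩ Set.Ioo (-(a ^ 2 + h)) 0) := h1.trans h2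
    _ = ENNReal.ofReal (h / 2) * (2 * volume (Bad ∩ Set.Ioo (-(a ^ 2 + h)) 0)) := by rw [e2, mul_assoc]

/-- **The smeared set has window density zero.**  If `Bad` is measurable with window density zero and `h > 0`, then
`{σ | h/2 < |Bad ∩ (σ−h, σ)|}` has window density zero (`volume_smeared_inter_window_le` and `(a²+h)/a² → 1`). [folklore] -/
theorem windowDensityZero_smeared {Bad : Set ℝ} (hBm : MeasurableSet Bad)
    (hBad : Tendsto (fun a : ℝ => volume (Bad ∩ Set.Ioo (-(a ^ 2)) 0) / ENNReal.ofReal (a ^ 2)) atTop (𝓝 0))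
    {h : ℝ} (hh : 0 < h) :
    Tendsto (fun a : ℝ => volume ({σ : ℝ | ENNReal.ofReal (h / 2) < volume (Bad ∩ Set.Ioo (σ - h) σ)} ∩
      Set.Ioo (-(a ^ 2)) 0) / ENNReal.ofReal (a ^ 2)) atTop (𝓝 0) := by
  -- the shifted scale `g a = √(a² + h)`, `(g a)² = a² + h`
  set g : ℝ → ℝ := fun a => Real.sqrt (a ^ 2 + h) with hg
  have hg2 : ∀ a, g a ^ 2 = a ^ 2 + h := fun a => Real.sq_sqrt (by positivity)
  have hgtop : Tendsto g atTop atTop := by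
    refine tendsto_atTop_atTop.2 fun b => ⟨max b 0, fun a ha => ?_⟩
    have ha0 : 0 ≤ a := le_trans (le_max_right _ _) ha
    calc b ≤ a := le_trans (le_max_left _ _) ha
      _ = Real.sqrt (a ^ 2) := (Real.sqrt_sq ha0).symm
      _ ≤ g a := Real.sqrt_le_sqrt (by linarith)
  -- the `Bad` density at the shifted scale tends to `0`
  have hB' : Tendsto (fun a : ℝ => volume (Bad ∩ Set.Ioo (-(a ^ 2 + h)) 0) / ENNReal.ofReal (a ^ 2 + h)) atTop (𝓝 0) := by
    have := hBad.comp hgtop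
    refine this.congr fun a => ?_
    simp only [Function.comp, hg2]
  -- the ratio of scales tends to `1`
  have hratio : Tendsto (fun a : ℝ => ENNReal.ofReal (a ^ 2 + h) / ENNReal.ofReal (a ^ 2)) atTop (𝓝 1) := by
    have hreal : Tendsto (fun a : ℝ => (a ^ 2 + h) / a ^ 2) atTop (𝓝 1) := by
      have h1 : Tendsto (fun a : ℝ => 1 + h * (a ^ 2)⁻¹) atTop (𝓝 (1 + h * 0)) :=
        tendsto_const_nhds.add ((tendsto_inv_atTop_zero.comp (tendsto_pow_atTop two_ne_zero)).const_mul h)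
      rw [mul_zero, add_zero] at h1
      refine h1.congr' ?_
      filter_upwards [eventually_gt_atTop 0] with a ha
      have : a ^ 2 ≠ 0 := by positivity
      field_simp
    have h2 := ENNReal.tendsto_ofReal hreal
    rw [ENNReal.ofReal_one] at h2
    refine h2.congr' ?_
    filter_upwards [eventually_gt_atTop 0] with a ha
    rw [ENNReal.ofReal_div_of_pos (by positivity)]
  -- product: `(|Bad ∩ I_{g a}| / (a²+h)) · ((a²+h)/a²) → 0 · 1`
  have hprod := ENNReal.Tendsto.mul hB' (Or.inr ENNReal.one_ne_top) hratio (Or.inl one_ne_zero)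
  rw [zero_mul] at hprod
  have hprod2 : Tendsto (fun a : ℝ => 2 * (volume (Bad ∩ Set.Ioo (-(a ^ 2 + h)) 0) / ENNReal.ofReal (a ^ 2 + h) *
      (ENNReal.ofReal (a ^ 2 + h) / ENNReal.ofReal (a ^ 2)))) atTop (𝓝 0) := by
    have := ENNReal.Tendsto.const_mul (a := 2) hprod (Or.inr (by norm_num))
    rwa [mul_zero] at this
  -- squeeze
  refine tendsto_of_tendsto_of_tendsto_of_le_of_le' tendsto_const_nhds hprod2 (Eventually.of_forall fun a => bot_le) ?_
  filter_upwards [eventually_gt_atTop 0] with a ha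
  have hne0 : ENNReal.ofReal (a ^ 2 + h) ≠ 0 := (ENNReal.ofReal_pos.2 (by positivity)).ne'
  have e : volume (Bad ∩ Set.Ioo (-(a ^ 2 + h)) 0) / ENNReal.ofReal (a ^ 2 + h) *
      (ENNReal.ofReal (a ^ 2 + h) / ENNReal.ofReal (a ^ 2)) =
      volume (Bad ∩ Set.Ioo (-(a ^ 2 + h)) 0) / ENNReal.ofReal (a ^ 2) := by
    rw [div_eq_mul_inv, div_eq_mul_inv, div_eq_mul_inv, mul_assoc, ← mul_assoc (ENNReal.ofReal (a ^ 2 + h))⁻¹,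
      ENNReal.inv_mul_cancel hne0 ENNReal.ofReal_ne_top, one_mul]
  rw [e, ← mul_div_assoc]
  exact ENNReal.div_le_div_right (volume_smeared_inter_window_le hBm hh a) _

/-! ### A good time in a window -/

/-- **A good time in the window.**  If in the window `W = (σ−h, σ)` (`h > 0`) a set `Bad` occupies measure `≤ h/2`, a measurable `G` occupies
`≤ h/4`, and `N` is null, then some `τ ∈ W` lies outside `Bad ∪ G ∪ N` (`|W| = h > h/2 + h/4`). [folklore] -/
theorem exists_good_time_in_window {Bad G N : Set ℝ} {σ h : ℝ} (hh : 0 < h)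
    (hBad : volume (Bad ∩ Set.Ioo (σ - h) σ) ≤ ENNReal.ofReal (h / 2))
    (hG : volume (G ∩ Set.Ioo (σ - h) σ) ≤ ENNReal.ofReal (h / 4)) (hN : volume N = 0) :
    ∃ τ ∈ Set.Ioo (σ - h) σ, τ ∉ Bad ∧ τ ∉ G ∧ τ ∉ N := by
  set W : Set ℝ := Set.Ioo (σ - h) σ with hW
  have hWvol : volume W = ENNReal.ofReal h := by rw [hW, Real.volume_Ioo]; ring_nf
  -- the exceptional part of the window has measure `< h`
  have hX : volume ((Bad ∪ G ∪ N) ∩ W) < volume W := by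
    calc volume ((Bad ∪ G ∪ N) ∩ W) ≤ volume (Bad ∩ W) + volume (G ∩ W) + volume (N ∩ W) := by
          rw [union_inter_distrib_right, union_inter_distrib_right]
          exact (measure_union_le _ _).trans (add_le_add (measure_union_le _ _) le_rfl)
      _ ≤ ENNReal.ofReal (h / 2) + ENNReal.ofReal (h / 4) + 0 :=
          add_le_add (add_le_add hBad hG) (by rw [measure_inter_null_of_null_left W hN])
      _ = ENNReal.ofReal (3 * h / 4) := by
          rw [add_zero, ← ENNReal.ofReal_add (by positivity) (by positivity)]
          congr 1
          ring
      _ < ENNReal.ofReal h := (ENNReal.ofReal_lt_ofReal_iff hh).2 (by linarith)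
      _ = volume W := hWvol.symm
  -- hence the good part is non-empty
  have hgood : volume (W \ (Bad ∪ G ∪ N)) ≠ 0 := by
    intro h0
    have : volume W ≤ volume ((Bad ∪ G ∪ N) ∩ W) := by
      calc volume W ≤ volume (W ∩ (Bad ∪ G ∪ N)) + volume (W \ (Bad ∪ G ∪ N)) :=
            measure_le_inter_add_sdiff _ _ _
        _ = volume ((Bad ∪ G ∪ N) ∩ W) := by rw [h0, add_zero, inter_comm]
    exact absurd this (not_le.2 hX)
  obtain ⟨τ, hτW, hτX⟩ := nonempty_of_measure_ne_zero hgood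
  simp only [mem_union, not_or] at hτX
  exact ⟨τ, hτW, hτX.1.1, hτX.1.2, hτX.2⟩

end Summit.NavierStokesRegularity.NavierStokesRegularity.Theorems.PowerGaugeEulerLiouville.RecurrentPast

end
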